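import Summits.ResolutionOfSingularities.ResolutionOfSingularities.Theorems.PurelyInseparableDim4LocalGameTorus
import HarnessLib
import HarnessLib.Audit.Tags

/-!
# Purely inseparable fourfolds — THE IN-SCOPE (F4-C) GAME IS TORUS-INVARIANT:
# `InScopeStateWins q ⟨c·F(νx), r, exc⟩ ↔ InScopeStateWins q ⟨F, r, exc⟩` for a unit `c` and a unit torus element `ν`
# [OURS · counted 0 · a symmetry of OUR frame-v4 game, not about resolution]

Census cell «res-dim4-pi» (D-0157 DOOR 2), desk WORD #164 (b) «∀K RESIDUE»; seat res-rescue-typ-3 g10.  The twin, for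
the in-scope attractor `InScopeWinCert.InScopeStateWins` (A: in-scope permissible coordinate centres, B: every
equimultiple `K`-point), of res-dim4-p-6's ✓ `Torus.rWins_C_mul_scale_iff` (`…LocalGameTorus`, the LOCAL game with the
`localB` letter): same induction on `Game.Wins`, one letter fewer — A repeats its centre, B's reply `b` against the
scaled state is the reply `μ•b` against the state (`μ` the chart torus of `ν`; ✓ `Torus.step_scale`, `step_C_mul`,
`isEquimultiplePoint_scale_iff`, `isEquimultiplePoint_C_mul_iff`, `isPermissibleCentre_scale_iff`,
`inCoordinateScope_C_mul_scale_iff`).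

* `inScopeStateWins_C_mul_scale` / **`inScopeStateWins_C_mul_scale_iff`**.
USE: the soundness of TORUS-FLAT absorption in the ∀K certificate format (children along a coordinate flat that are
torus-equivalent to one 𝔽_p-point child; design `pub/res-hironaka/plan/rescue/typ-3/v4/g10/notes/TORUS-FLAT-KIND-SPEC.md`).
Nothing here proves resolution of singularities in dimension ≥ 4 / characteristic `p`; F4-C(2,2) stays OPEN.
Counted 0; AI work, weaker than expert review.
bears_on: LADDER-RESOLUTION:D157-DOOR2 (res-dim4-pi · F4-C ∀K column · torus symmetry of the in-scope game).
Supports stmt-ResolutionOfSingularities-16155 (helper).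
-/

set_option linter.dupNamespace false

noncomputable section

open MvPolynomial Finset
open scoped BigOperators

namespace Summit.ResolutionOfSingularities.ResolutionOfSingularities.Theorems.PIDim4

namespace Torus

open Literature.AlgebraicGeometry.Resolution
open Literature.AlgebraicGeometry.Resolution.Hauser2010
open Literature.AlgebraicGeometry.Resolution.CentreBlowup
open InScopeWinCert

variable {K : Type} [Field K] [DecidableEq K]

/-- **Every in-scope A-win transports along the orbit** `F ↦ c·F(νx)`. OURS. [folklore] -/
theorem inScopeStateWins_C_mul_scale {q : ℕ} {s : State K} (h : InScopeStateWins q s) :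
    ∀ (c : K) (ν : Fin 4 → K), c ≠ 0 → (∀ i, ν i ≠ 0) →
      InScopeStateWins q (⟨C c * aeval (fun i => C (ν i) * X i) s.F, s.r, s.exc⟩ : State K) := by
  unfold InScopeStateWins at h ⊢
  induction h with
  | terminal h0 =>
    intro c ν hc hν
    refine Game.Wins.terminal fun S hS => h0 S ?_
    exact ⟨(inCoordinateScope_C_mul_scale_iff q hc hν _).mp hS.1, (isPermissibleCentre_scale_iff hc hν q S _).mp hS.2⟩
  | @move x S hlegal _ ih =>
    intro c ν hc hν
    refine Game.Wins.move (m := S) ⟨(inCoordinateScope_C_mul_scale_iff q hc hν _).mpr hlegal.1,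
      (isPermissibleCentre_scale_iff hc hν q S _).mpr hlegal.2⟩ ?_
    rintro t' ⟨j, b, hj, hbj, heq, hne, rfl⟩
    have hq : ∀ d ∈ x.F.support, q ≤ degIn S d := le_degIn_of_le_ordAlong hlegal.2.2
    -- the chart torus `μ` of `ν`
    generalize hμ : (fun i => if i ∈ S ∧ i ≠ j then ν i / ν j else ν i) = μ
    have hμi : ∀ i, μ i = if i ∈ S ∧ i ≠ j then ν i / ν j else ν i := fun i => by rw [← hμ]
    have hμne : ∀ i, μ i ≠ 0 := fun i => by
      rw [hμi]
      split_ifs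
      · exact div_ne_zero (hν i) (hν j)
      · exact hν i
    have hμj : μ j = ν j := by rw [hμi j, if_neg (fun h => h.2 rfl)]
    have hlam : ∀ i, ν i = if i ∈ S ∧ i ≠ j then μ i * μ j else μ i := fun i => by
      by_cases h : i ∈ S ∧ i ≠ j
      · rw [if_pos h, hμi i, if_pos h, hμj, div_mul_cancel₀ _ (hν j)]
      · rw [if_neg h, hμi i, if_neg h]
    -- the reply `b` against the scaled state is the reply `μ•b` against the state
    set t := CentreBlowup.step q S j (fun i => μ i * b i) x with ht
    have heq0 : IsEquimultiplePoint q S j (fun i => μ i * b i) x :=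
      (isEquimultiplePoint_scale_iff hj hμne ν hlam b x hq).mp
        ((isEquimultiplePoint_C_mul_iff q S j hc b _ x.r x.exc).mp heq)
    have hstep : CentreBlowup.step q S j b (⟨C c * aeval (fun i => C (ν i) * X i) x.F, x.r, x.exc⟩ : State K) =
        ⟨C (c * μ j ^ q) * aeval (fun i => C (μ i) * X i) t.F, t.r, t.exc⟩ := by
      rw [step_C_mul q S j hc b _ x.r x.exc, step_scale hj hμne ν hlam b x hq, ← ht, map_mul, mul_assoc]
    have hne0 : t.F ≠ 0 := by
      intro h0
      apply hne
      rw [hstep, h0, map_zero, mul_zero]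
    have hbj0 : μ j * b j = 0 := by rw [hbj, mul_zero]
    rw [hstep]
    exact ih t ⟨j, fun i => μ i * b i, hj, hbj0, heq0, hne0, ht⟩ _ _
      (mul_ne_zero hc (pow_ne_zero _ (hμne j))) hμne

/-- **THE IN-SCOPE GAME IS TORUS-INVARIANT**: `⟨c·F(νx), r, exc⟩` is in-scope escapable iff `⟨F, r, exc⟩` is
(`c ∈ K*`, `ν ∈ (K*)⁴`). OURS. [folklore] -/
theorem inScopeStateWins_C_mul_scale_iff {q : ℕ} {c : K} (hc : c ≠ 0) {ν : Fin 4 → K} (hν : ∀ i, ν i ≠ 0)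
    (F : MvPolynomial (Fin 4) K) (r : Fin 4 →₀ ℕ) (exc : Finset (Fin 4)) :
    InScopeStateWins q (⟨C c * aeval (fun i => C (ν i) * X i) F, r, exc⟩ : State K) ↔
      InScopeStateWins q (⟨F, r, exc⟩ : State K) := by
  refine ⟨fun h => ?_, fun h => inScopeStateWins_C_mul_scale h c ν hc hν⟩
  have h' := inScopeStateWins_C_mul_scale h c⁻¹ (fun i => (ν i)⁻¹) (inv_ne_zero hc) (fun i => inv_ne_zero (hν i))
  rwa [C_mul_scale_inv hc hν] at h'

end Torus

end Summit.ResolutionOfSingularities.ResolutionOfSingularities.Theorems.PIDim4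

end
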